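import Literature.Analysis.FluidPDE.OseenSchemeComplexDuhamel
import Literature.Analysis.FluidPDE.OseenSchemeComplexCovariance
import Literature.Analysis.FluidPDE.OseenSchemeComplexReal
import Literature.Analysis.Complex.LocallyUniformLimitSCV
import Mathlib.Analysis.SpecificLimits.Basic
import HarnessLib

/-!
# The complexified Oseen scheme: the Picard iteration, its holomorphic limit, and the real solution

Analysis/FluidPDE file (three small definitions — the iterates `picardC`, their limit
`picardLimitC`, its real restriction `picardLimitReal` — and two constants; everything else
proved), layer W4 of the proof of the local analyticity of bounded mild solutions in the tree's
complexified Oseen scheme (`OseenSchemeComplex.lean`: root time `m`, `m² = νt`, complex Galilean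
parameter `g`; `freeTermC`, `duhamelC`, the class `IsSchemeField ν T₀ K` on `schemeDomain ν T₀`;
Lemarié-Rieusset 2016, Thm. 9.12, proof pp. 260–263, after Thm. 5.1 = Oseen's method), consumed
by `NSAnalyticityRadiusLinfty.lean` (Guberović 2010) and available to `NSBoundedMildAnalytic.lean`.

* `freeConstC ι = e²(25/6)^{d/2}` (the bound of the free term, `isSchemeField_freeTermC`) and
  `duhamelConstC ι` (the constant of `exists_isSchemeField_duhamelC`, chosen once), with
  `isSchemeField_duhamelC`;
* `picardC ν b k` — **Oseen's successive approximations, complexified**: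
  `V₀ = freeTermC b`, `V_{k+1} = freeTermC b - duhamelC ν V_k V_k` (Lemarié-Rieusset 2016,
  p. 261: `V₀(τ,z)`, `V_{k+1}(τ,z)`; here the iterates of the fixed-point map rather than the
  terms of the series (9.38)). The recursion does not mention `T₀`: the SAME functions are scheme
  fields on `schemeDomain ν T₀` for every `T₀` satisfying the smallness condition
  `8 C_B (√(νT₀)/ν) K_G M ≤ 1` (`isSchemeField_picardC`, bound `2 K_G M`), with the geometric
  decay `‖V_{k+1} - V_k‖ ≤ 2K_G M/2^k` on `schemeDomain ν T₀ × ℝ^ι` (`norm_picardC_succ_sub_le`,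
  the contraction step via `duhamelC_self_sub_self`);
* `picardLimitC ν b` — the pointwise limit; on `schemeDomain ν T₀` (smallness as above) the
  iterates converge uniformly on `schemeDomain × ℝ^ι` (`tendstoUniformlyOn_picardC`), so the
  limit is jointly continuous, bounded by `2K_G M`, and **holomorphic in the parameters**
  (Weierstrass' theorem in several variables, `SCV.differentiableOn_of_tendstoLocallyUniformlyOn`
  on the finite-dimensional `ℂ × ℂ^ι`): `isSchemeField_picardLimitC`; it solves the fixed-point
  equation `U = freeTermC b - duhamelC ν U U` on the domain (`picardLimitC_eq`), is real on the
  real time axis (`picardLimitC_real`, via `real_on_axis_of_tendsto`) and Galilean covariant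
  (`isGalileanCovariantOn_picardLimitC`);
* `picardLimitReal ν b t z = Re U(√(νt), 0) z` — **the real restriction is the bounded mild
  solution**: `u(t) = e^{νtΔ}b - B^ν_0(u,u)(t)` pointwise on `(0, T₀) × ℝ^ι`
  (`picardLimitReal_eq`, by `scheme_sqrt_zero`), `‖u‖ ≤ 2K_G M`, `uncurry u` continuous on
  `(0,T₀) × ℝ^ι`, and `U(√(νt), 0) z = cx (u t z)`.

What is NOT here: the identification of the spatial tube / Galilean chart (done by the consumers:
`NSAnalyticityRadiusLinfty.lean` for the tube `|Im z| < νt/√(νT₀)`, `OseenSchemeRealAnalytic.lean`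
for joint real-analyticity), uniqueness (the tree's `oseenMild_essBounded_unique`), and general
initial times (time translation, `oseenDuhamel_translate`).

## Mathlib / tree search

Tree: W3a–W3c and W3b-2 (`isSchemeField_freeTermC`, `exists_isSchemeField_duhamelC`,
`duhamelC_self_sub_self`, `IsGalileanCovariantOn.scheme/.of_tendsto`, `scheme_sqrt_zero`,
`freeTermC_sqrt_zero`, `real_on_axis_of_tendsto`, `eq_complexify_realPart_of_mem_range`,
`sqrt_mem_schemeDomain`, `isOpen_schemeDomain`), `SCV.differentiableOn_of_tendstoLocallyUniformlyOn`
(`Complex/LocallyUniformLimitSCV.lean`). Mathlib: `cauchySeq_of_le_geometric_two`,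
`dist_le_of_le_geometric_two_of_tendsto`, `CauchySeq.tendsto_limUnder`,
`TendstoUniformlyOn.continuousOn`, `Metric.tendstoUniformlyOn_iff`, `tendsto_nhds_unique`.

## References

* P. G. Lemarié-Rieusset, *The Navier–Stokes Problem in the 21st Century*, CRC Press 2016,
  doi:10.1201/b19556, Thm. 9.12 and its proof, PDF pp. 260–263; Thm. 5.1 (Oseen's scheme),
  pp. 103–105. [LemarieRieusset2016]
-/

noncomputable section

open MeasureTheory Set Filter Metric Real
open _root_.Topology
open scoped BigOperators

namespace Literature.Analysis.FluidPDE

open Literature.Analysis.FunctionSpaces.EuclideanSpace (complexify complexify_apply norm_complexify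
  continuous_complexify complexify_injective)
open UnboundedOperators (heatExtension)

variable {ι : Type*} [Fintype ι]

/-! ### The two constants -/

section Constants

variable (ι)

/-- **The constant of the free term**, `K_G = e² (25/6)^{d/2}`: `‖freeTermC b‖ ≤ K_G M` for
data bounded by `M` (`isSchemeField_freeTermC`; Lemarié-Rieusset 2016, p. 262, `C_γ`). [cite: LemarieRieusset2016, Thm. 9.12 (proof, p. 262)] -/
def freeConstC : ℝ := Real.exp 2 * (25 / 6 : ℝ) ^ ((Fintype.card ι : ℝ) / 2)

/-- `K_G > 0`. [folklore] -/
theorem freeConstC_pos : 0 < freeConstC ι := by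
  unfold freeConstC; positivity

/-- **The constant of the bilinear term**, `C_B = C_B(ι) > 0`: `duhamelC ν V W` is a scheme field
with bound `C_B (√(νT₀)/ν) K_V K_W` (`exists_isSchemeField_duhamelC`, chosen once and for all;
Lemarié-Rieusset 2016, p. 263, `C'_γ`). [cite: LemarieRieusset2016, Thm. 9.12 (proof, p. 263)] -/
def duhamelConstC : ℝ := Classical.choose (exists_isSchemeField_duhamelC (ι := ι))

/-- `C_B > 0`. [folklore] -/
theorem duhamelConstC_pos : 0 < duhamelConstC ι :=
  (Classical.choose_spec (exists_isSchemeField_duhamelC (ι := ι))).1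

variable {ι}

/-- **The bilinear term of scheme fields is a scheme field**, with the chosen constant:
bound `C_B (√(νT₀)/ν) K_V K_W`. [cite: LemarieRieusset2016, Thm. 9.12 (proof, p. 263)] -/
theorem isSchemeField_duhamelC {ν T₀ : ℝ} (hν : 0 < ν)
    {V W : ℂ × EuclideanSpace ℂ ι → EuclideanSpace ℝ ι → EuclideanSpace ℂ ι} {KV KW : ℝ}
    (hKV : 0 ≤ KV) (hKW : 0 ≤ KW) (hV : IsSchemeField ν T₀ KV V) (hW : IsSchemeField ν T₀ KW W) :
    IsSchemeField ν T₀ (duhamelConstC ι * (Real.sqrt (ν * T₀) / ν) * KV * KW) (duhamelC ν V W) :=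
  (Classical.choose_spec (exists_isSchemeField_duhamelC (ι := ι))).2 hν hKV hKW hV hW

end Constants

/-- A difference of scheme fields with a known pointwise bound `d` of the difference is a scheme
field with bound `d`. [folklore] -/
theorem IsSchemeField.sub_of_norm_le {ν T₀ KV KW d : ℝ}
    {V W : ℂ × EuclideanSpace ℂ ι → EuclideanSpace ℝ ι → EuclideanSpace ℂ ι}
    (hV : IsSchemeField ν T₀ KV V) (hW : IsSchemeField ν T₀ KW W)
    (hd : ∀ p ∈ schemeDomain ν T₀, ∀ x, ‖V p x - W p x‖ ≤ d) :
    IsSchemeField ν T₀ d (fun p x => V p x - W p x) :=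
  ⟨(hV.sub hW).continuousOn, hd, (hV.sub hW).differentiableOn⟩

/-! ### The iterates and their limit -/

/-- **The Picard iterates of the complexified Oseen scheme** from the datum `b`:
`V₀ = freeTermC b`, `V_{k+1} = freeTermC b - duhamelC ν V_k V_k` (Lemarié-Rieusset 2016, proof
of Thm. 9.12, p. 261, `V₀(τ,z)` and the recursion for `V_{k+1}(τ,z)`; Thm. 5.1, Oseen's
successive approximations). Defined for all parameters; meaningful on `schemeDomain ν T₀`.
[cite: LemarieRieusset2016, Thm. 9.12 (proof, p. 261)] -/
def picardC (ν : ℝ) (b : EuclideanSpace ℝ ι → EuclideanSpace ℝ ι) :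
    ℕ → ℂ × EuclideanSpace ℂ ι → EuclideanSpace ℝ ι → EuclideanSpace ℂ ι
  | 0 => freeTermC b
  | k + 1 => fun p x => freeTermC b p x - duhamelC ν (picardC ν b k) (picardC ν b k) p x

/-- The zeroth iterate is the free term. [folklore] -/
theorem picardC_zero (ν : ℝ) (b : EuclideanSpace ℝ ι → EuclideanSpace ℝ ι) :
    picardC ν b 0 = freeTermC b := rfl

/-- The recursion of the iterates. [folklore] -/
theorem picardC_succ (ν : ℝ) (b : EuclideanSpace ℝ ι → EuclideanSpace ℝ ι) (k : ℕ) :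
    picardC ν b (k + 1) = fun p x => freeTermC b p x - duhamelC ν (picardC ν b k) (picardC ν b k) p x :=
  rfl

/-- **The limit of the Picard iteration** of the complexified scheme (pointwise `limUnder`; a junk
value where the iteration does not converge, never on `schemeDomain ν T₀` under the smallness
condition). [cite: LemarieRieusset2016, Thm. 9.12 (proof, p. 263: the sum of the series)] -/
def picardLimitC (ν : ℝ) (b : EuclideanSpace ℝ ι → EuclideanSpace ℝ ι) (p : ℂ × EuclideanSpace ℂ ι)
    (x : EuclideanSpace ℝ ι) : EuclideanSpace ℂ ι :=
  limUnder atTop fun k => picardC ν b k p x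

/-- **The real restriction of the limit** on the real time axis: `u t z = Re U(√(νt), 0) z`.
[cite: LemarieRieusset2016, Thm. 9.12 (proof, (9.38) p. 260)] -/
def picardLimitReal (ν : ℝ) (b : EuclideanSpace ℝ ι → EuclideanSpace ℝ ι) (t : ℝ)
    (z : EuclideanSpace ℝ ι) : EuclideanSpace ℝ ι :=
  realPart (picardLimitC ν b ((((Real.sqrt (ν * t) : ℝ) : ℂ)), 0) z)

/-! ### Reality on the real time axis and Galilean covariance of the iterates -/

/-- **Every iterate is real on the real time axis**: for `ν, t > 0`,
`V_k(√(νt), 0) z = cx (Re V_k(√(νt), 0) z)` (the free term is the caloric extension there, and the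
scheme map preserves reality, `scheme_sqrt_zero`). [folklore] -/
theorem picardC_real {ν : ℝ} (hν : 0 < ν) (b : EuclideanSpace ℝ ι → EuclideanSpace ℝ ι) (k : ℕ) :
    ∀ {t : ℝ}, 0 < t → ∀ z : EuclideanSpace ℝ ι,
      picardC ν b k ((((Real.sqrt (ν * t) : ℝ) : ℂ)), 0) z =
        complexify (realPart (picardC ν b k ((((Real.sqrt (ν * t) : ℝ) : ℂ)), 0) z)) := by
  induction k with
  | zero =>
    intro t ht z
    rw [picardC_zero, freeTermC_sqrt_zero hν ht b z, realPart_complexify]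
  | succ k ih =>
    intro t ht z
    have hV : ∀ σ ∈ Ioo 0 (t + 1), ∀ w : EuclideanSpace ℝ ι,
        picardC ν b k ((((Real.sqrt (ν * σ) : ℝ) : ℂ)), 0) w =
          complexify (realPart (picardC ν b k ((((Real.sqrt (ν * σ) : ℝ) : ℂ)), 0) w)) :=
      fun σ hσ w => ih hσ.1 w
    have h := scheme_sqrt_zero hν (v := fun σ w =>
      realPart (picardC ν b k ((((Real.sqrt (ν * σ) : ℝ) : ℂ)), 0) w)) hV b
      (t := t) ⟨ht, by linarith⟩ z
    rw [picardC_succ]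
    simp only
    rw [h, realPart_complexify]

/-- **Every iterate is Galilean covariant** on `schemeDomain ν T₀`, for every `T₀` (the free term
is, and the scheme map preserves covariance). [folklore] -/
theorem isGalileanCovariantOn_picardC (ν T₀ : ℝ) (b : EuclideanSpace ℝ ι → EuclideanSpace ℝ ι)
    (k : ℕ) : IsGalileanCovariantOn (schemeDomain ν T₀) (picardC ν b k) := by
  induction k with
  | zero => exact isGalileanCovariantOn_freeTermC b ν T₀
  | succ k ih => exact ih.scheme b

/-! ### The iteration under the smallness condition -/

section Iteration

variable {ν T₀ M : ℝ} {b : EuclideanSpace ℝ ι → EuclideanSpace ℝ ι}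
  (hν : 0 < ν) (hb : AEStronglyMeasurable b volume) (hM : 0 ≤ M) (hbM : ∀ y, ‖b y‖ ≤ M)
  (hsmall : 8 * (duhamelConstC ι * (Real.sqrt (ν * T₀) / ν)) * freeConstC ι * M ≤ 1)

include hν hb hM hbM hsmall

/-- **The iterates are scheme fields with the common bound `2 K_G M`** on `schemeDomain ν T₀`
under the smallness condition `8 C_B (√(νT₀)/ν) K_G M ≤ 1` (Lemarié-Rieusset 2016, proof of
Thm. 5.1 / Thm. 9.12 p. 263: the induction "`V_k` is holomorphic and bounded on `t₀ + Ω_γ`").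
[cite: LemarieRieusset2016, Thm. 9.12 (proof, pp. 262–263)] -/
theorem isSchemeField_picardC (k : ℕ) :
    IsSchemeField ν T₀ (2 * freeConstC ι * M) (picardC ν b k) := by
  have hKG := freeConstC_pos ι
  have hCB := duhamelConstC_pos ι
  have hlam : 0 ≤ duhamelConstC ι * (Real.sqrt (ν * T₀) / ν) := by positivity
  have h0 : IsSchemeField ν T₀ (freeConstC ι * M) (freeTermC b) := isSchemeField_freeTermC hb hM hbM
  induction k with
  | zero =>
    rw [picardC_zero]
    exact h0.mono (by nlinarith)
  | succ k ih =>
    have hK : 0 ≤ 2 * freeConstC ι * M := by positivity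
    have hD := isSchemeField_duhamelC hν hK hK ih ih
    rw [picardC_succ]
    refine (h0.sub hD).mono ?_
    have hKM : 0 ≤ freeConstC ι * M := by positivity
    have key : duhamelConstC ι * (Real.sqrt (ν * T₀) / ν) * (2 * freeConstC ι * M) *
        (2 * freeConstC ι * M) ≤ freeConstC ι * M := by
      have h1 : duhamelConstC ι * (Real.sqrt (ν * T₀) / ν) * (2 * freeConstC ι * M) *
          (2 * freeConstC ι * M) =
          (8 * (duhamelConstC ι * (Real.sqrt (ν * T₀) / ν)) * freeConstC ι * M) *
            (freeConstC ι * M) / 2 := by ring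
      rw [h1]
      have h2 : (8 * (duhamelConstC ι * (Real.sqrt (ν * T₀) / ν)) * freeConstC ι * M) *
          (freeConstC ι * M) ≤ 1 * (freeConstC ι * M) :=
        mul_le_mul_of_nonneg_right hsmall hKM
      linarith
    linarith

/-- **Geometric decay of the increments**: `‖V_{k+1} - V_k‖ ≤ 2K_G M / 2^k` on
`schemeDomain ν T₀ × ℝ^ι` (the contraction step: `V_{k+2} - V_{k+1} =
-(𝓑(V_{k+1} - V_k, V_{k+1}) + 𝓑(V_k, V_{k+1} - V_k))`, each term `≤ C_B(√(νT₀)/ν)(2K_G M) d_k`,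
and `4 C_B (√(νT₀)/ν) K_G M ≤ 1/2`; Lemarié-Rieusset 2016, proof of Thm. 5.1). [cite: LemarieRieusset2016, Thm. 5.1 (proof, pp. 103–105) and Thm. 9.12 (proof, p. 263)] -/
theorem norm_picardC_succ_sub_le (k : ℕ) :
    ∀ p ∈ schemeDomain (ι := ι) ν T₀, ∀ x : EuclideanSpace ℝ ι,
      ‖picardC ν b (k + 1) p x - picardC ν b k p x‖ ≤ 2 * freeConstC ι * M / 2 ^ k := by
  have hKG := freeConstC_pos ι
  have hCB := duhamelConstC_pos ι
  set lam : ℝ := duhamelConstC ι * (Real.sqrt (ν * T₀) / ν) with hlam_def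
  have hlam : 0 ≤ lam := by positivity
  have hK : 0 ≤ 2 * freeConstC ι * M := by positivity
  have hhalf : lam * (2 * freeConstC ι * M) ≤ 1 / 4 := by
    have : lam * (2 * freeConstC ι * M) = (8 * lam * freeConstC ι * M) / 4 := by ring
    rw [this]; linarith
  induction k with
  | zero =>
    intro p hp x
    have hV0 := isSchemeField_picardC hν hb hM hbM hsmall 0
    have hD := (isSchemeField_duhamelC hν hK hK hV0 hV0).norm_le p hp x
    rw [picardC_succ, picardC_zero] at *
    simp only [sub_sub_cancel_left, norm_neg, pow_zero, div_one]
    calc _ ≤ _ := hD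
      _ = (lam * (2 * freeConstC ι * M)) * (2 * freeConstC ι * M) := by rw [hlam_def]
      _ ≤ 1 / 4 * (2 * freeConstC ι * M) := mul_le_mul_of_nonneg_right hhalf hK
      _ ≤ 2 * freeConstC ι * M := by nlinarith
  | succ k ih =>
    intro p hp x
    set d : ℝ := 2 * freeConstC ι * M / 2 ^ k with hd
    have hd0 : 0 ≤ d := by positivity
    have hVk := isSchemeField_picardC hν hb hM hbM hsmall k
    have hVk1 := isSchemeField_picardC hν hb hM hbM hsmall (k + 1)
    have hdiff : IsSchemeField ν T₀ d (fun q z => picardC ν b (k + 1) q z - picardC ν b k q z) :=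
      hVk1.sub_of_norm_le hVk ih
    have h1 := (isSchemeField_duhamelC hν hd0 hK hdiff hVk1).norm_le p hp x
    have h2 := (isSchemeField_duhamelC hν hK hd0 hVk hdiff).norm_le p hp x
    have heq : picardC ν b (k + 1 + 1) p x - picardC ν b (k + 1) p x =
        -(duhamelC ν (picardC ν b (k + 1)) (picardC ν b (k + 1)) p x -
          duhamelC ν (picardC ν b k) (picardC ν b k) p x) := by
      rw [picardC_succ ν b (k + 1), picardC_succ ν b k]
      simp only
      abel
    rw [heq, norm_neg, duhamelC_self_sub_self hK hK hVk1 hVk hp x]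
    calc _ ≤ ‖duhamelC ν (fun q z => picardC ν b (k + 1) q z - picardC ν b k q z) (picardC ν b (k + 1)) p x‖ +
          ‖duhamelC ν (picardC ν b k) (fun q z => picardC ν b (k + 1) q z - picardC ν b k q z) p x‖ :=
        norm_add_le _ _
      _ ≤ lam * d * (2 * freeConstC ι * M) + lam * (2 * freeConstC ι * M) * d := by
        refine add_le_add ?_ ?_
        · calc _ ≤ _ := h1
            _ = lam * d * (2 * freeConstC ι * M) := by rw [hlam_def]
        · calc _ ≤ _ := h2
            _ = lam * (2 * freeConstC ι * M) * d := by rw [hlam_def]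
      _ = 2 * (lam * (2 * freeConstC ι * M)) * d := by ring
      _ ≤ 2 * (1 / 4) * d := by gcongr
      _ = 2 * freeConstC ι * M / 2 ^ (k + 1) := by rw [hd, pow_succ]; ring

/-- The increments in Mathlib's `C/2/2^k` form. [folklore] -/
theorem dist_picardC_succ_le (k : ℕ) {p : ℂ × EuclideanSpace ℂ ι}
    (hp : p ∈ schemeDomain (ι := ι) ν T₀) (x : EuclideanSpace ℝ ι) :
    dist (picardC ν b k p x) (picardC ν b (k + 1) p x) ≤ 4 * freeConstC ι * M / 2 / 2 ^ k := by
  rw [dist_comm, dist_eq_norm, show 4 * freeConstC ι * M / 2 / 2 ^ k = 2 * freeConstC ι * M / 2 ^ k by ring]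
  exact norm_picardC_succ_sub_le hν hb hM hbM hsmall k p hp x

/-- **The iterates converge to the limit** on `schemeDomain ν T₀ × ℝ^ι`. [folklore] -/
theorem tendsto_picardC {p : ℂ × EuclideanSpace ℂ ι} (hp : p ∈ schemeDomain (ι := ι) ν T₀)
    (x : EuclideanSpace ℝ ι) :
    Tendsto (fun k => picardC ν b k p x) atTop (𝓝 (picardLimitC ν b p x)) :=
  (cauchySeq_of_le_geometric_two (fun k => dist_picardC_succ_le hν hb hM hbM hsmall k hp x)).tendsto_limUnder

/-- **Uniform geometric rate**: `‖V_k - U‖ ≤ 4K_G M / 2^k` on `schemeDomain ν T₀ × ℝ^ι`.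
[folklore] -/
theorem norm_picardC_sub_picardLimitC_le (k : ℕ) {p : ℂ × EuclideanSpace ℂ ι}
    (hp : p ∈ schemeDomain (ι := ι) ν T₀) (x : EuclideanSpace ℝ ι) :
    ‖picardC ν b k p x - picardLimitC ν b p x‖ ≤ 4 * freeConstC ι * M / 2 ^ k := by
  rw [← dist_eq_norm]
  exact dist_le_of_le_geometric_two_of_tendsto (fun k => dist_picardC_succ_le hν hb hM hbM hsmall k hp x)
    (tendsto_picardC hν hb hM hbM hsmall hp x) k

/-- The limit is bounded by `2 K_G M` on the domain. [folklore] -/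
theorem norm_picardLimitC_le {p : ℂ × EuclideanSpace ℂ ι} (hp : p ∈ schemeDomain (ι := ι) ν T₀)
    (x : EuclideanSpace ℝ ι) : ‖picardLimitC ν b p x‖ ≤ 2 * freeConstC ι * M :=
  le_of_tendsto ((continuous_norm.tendsto _).comp (tendsto_picardC hν hb hM hbM hsmall hp x))
    (Eventually.of_forall fun k => (isSchemeField_picardC hν hb hM hbM hsmall k).norm_le p hp x)

omit hν hb hM hbM hsmall in
/-- The rate `4K_G M/2^k` tends to `0`. [folklore] -/
theorem tendsto_rate_zero : Tendsto (fun k : ℕ => 4 * freeConstC ι * M / 2 ^ k) atTop (𝓝 0) :=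
  tendsto_const_nhds.div_atTop (tendsto_pow_atTop_atTop_of_one_lt one_lt_two)

/-- **Uniform convergence of the iterates on `schemeDomain × ℝ^ι`** (jointly in `(p, x)`).
[folklore] -/
theorem tendstoUniformlyOn_picardC :
    TendstoUniformlyOn (fun k (q : (ℂ × EuclideanSpace ℂ ι) × EuclideanSpace ℝ ι) => picardC ν b k q.1 q.2)
      (fun q => picardLimitC ν b q.1 q.2) atTop (schemeDomain ν T₀ ×ˢ univ) := by
  rw [Metric.tendstoUniformlyOn_iff]
  intro ε hε
  filter_upwards [(tendsto_rate_zero (ι := ι) (M := M)).eventually (gt_mem_nhds hε)] with k hk q hq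
  rw [dist_comm, dist_eq_norm]
  exact (norm_picardC_sub_picardLimitC_le hν hb hM hbM hsmall k (mem_prod.1 hq).1 q.2).trans_lt hk

/-- Uniform convergence in the parameters for a fixed space point. [folklore] -/
theorem tendstoUniformlyOn_picardC_apply (x : EuclideanSpace ℝ ι) :
    TendstoUniformlyOn (fun k p => picardC ν b k p x) (fun p => picardLimitC ν b p x) atTop
      (schemeDomain (ι := ι) ν T₀) := by
  rw [Metric.tendstoUniformlyOn_iff]
  intro ε hε
  filter_upwards [(tendsto_rate_zero (ι := ι) (M := M)).eventually (gt_mem_nhds hε)] with k hk p hp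
  rw [dist_comm, dist_eq_norm]
  exact (norm_picardC_sub_picardLimitC_le hν hb hM hbM hsmall k hp x).trans_lt hk

/-- **The limit is jointly continuous on `schemeDomain × ℝ^ι`** (uniform limit of jointly
continuous fields). [folklore] -/
theorem continuousOn_picardLimitC :
    ContinuousOn (Function.uncurry (picardLimitC ν b)) (schemeDomain ν T₀ ×ˢ univ) :=
  (tendstoUniformlyOn_picardC hν hb hM hbM hsmall).continuousOn
    (Frequently.of_forall fun k => (isSchemeField_picardC hν hb hM hbM hsmall k).continuousOn)

/-- **The limit is holomorphic in the parameters** (Weierstrass' theorem in several complex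
variables on the open `schemeDomain ⊆ ℂ × ℂ^ι`: locally uniform limit of the holomorphic
iterates; Lemarié-Rieusset 2016, p. 263: "the series converges normally … `u` has a holomorphic
extension"). [cite: LemarieRieusset2016, Thm. 9.12 (proof, p. 263)] -/
theorem differentiableOn_picardLimitC (x : EuclideanSpace ℝ ι) :
    DifferentiableOn ℂ (fun p => picardLimitC ν b p x) (schemeDomain (ι := ι) ν T₀) :=
  Complex.SCV.differentiableOn_of_tendstoLocallyUniformlyOn (isOpen_schemeDomain ν T₀)
    (fun k => (isSchemeField_picardC hν hb hM hbM hsmall k).differentiableOn x)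
    (tendstoUniformlyOn_picardC_apply hν hb hM hbM hsmall x).tendstoLocallyUniformlyOn

/-- **The limit is a scheme field with bound `2 K_G M`.** [cite: LemarieRieusset2016, Thm. 9.12 (proof, p. 263)] -/
theorem isSchemeField_picardLimitC : IsSchemeField ν T₀ (2 * freeConstC ι * M) (picardLimitC ν b) :=
  ⟨continuousOn_picardLimitC hν hb hM hbM hsmall, fun _ hp x => norm_picardLimitC_le hν hb hM hbM hsmall hp x,
    differentiableOn_picardLimitC hν hb hM hbM hsmall⟩

/-- **The limit solves the fixed-point equation of the complexified scheme** on the domain: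
`U = freeTermC b - duhamelC ν U U` (pass to the limit in the recursion; the bilinear term
converges by the splitting `𝓑(V_k,V_k) - 𝓑(U,U) = 𝓑(V_k - U, V_k) + 𝓑(U, V_k - U)` and the
uniform rate). [cite: LemarieRieusset2016, Thm. 9.12 (proof, p. 263) and Thm. 5.1] -/
theorem picardLimitC_eq {p : ℂ × EuclideanSpace ℂ ι} (hp : p ∈ schemeDomain (ι := ι) ν T₀)
    (x : EuclideanSpace ℝ ι) :
    picardLimitC ν b p x =
      freeTermC b p x - duhamelC ν (picardLimitC ν b) (picardLimitC ν b) p x := by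
  have hKG := freeConstC_pos ι
  have hCB := duhamelConstC_pos ι
  set lam : ℝ := duhamelConstC ι * (Real.sqrt (ν * T₀) / ν) with hlam_def
  have hlam : 0 ≤ lam := by positivity
  have hK : 0 ≤ 2 * freeConstC ι * M := by positivity
  have hU := isSchemeField_picardLimitC hν hb hM hbM hsmall
  -- the bilinear term converges
  have hD : Tendsto (fun k => duhamelC ν (picardC ν b k) (picardC ν b k) p x) atTop
      (𝓝 (duhamelC ν (picardLimitC ν b) (picardLimitC ν b) p x)) := by
    rw [tendsto_iff_norm_sub_tendsto_zero]
    have hrate : Tendsto (fun k : ℕ => 2 * (lam * (2 * freeConstC ι * M)) * (4 * freeConstC ι * M / 2 ^ k))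
        atTop (𝓝 0) := by
      simpa using (tendsto_rate_zero (ι := ι) (M := M)).const_mul
        (2 * (lam * (2 * freeConstC ι * M)))
    refine squeeze_zero (fun k => norm_nonneg _) (fun k => ?_) hrate
    set ε : ℝ := 4 * freeConstC ι * M / 2 ^ k with hε
    have hε0 : 0 ≤ ε := by positivity
    have hVk := isSchemeField_picardC hν hb hM hbM hsmall k
    have hdiff : IsSchemeField ν T₀ ε (fun q z => picardC ν b k q z - picardLimitC ν b q z) :=
      hVk.sub_of_norm_le hU fun q hq z => norm_picardC_sub_picardLimitC_le hν hb hM hbM hsmall k hq z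
    have h1 := (isSchemeField_duhamelC hν hε0 hK hdiff hVk).norm_le p hp x
    have h2 := (isSchemeField_duhamelC hν hK hε0 hU hdiff).norm_le p hp x
    rw [duhamelC_self_sub_self hK hK hVk hU hp x]
    calc _ ≤ ‖duhamelC ν (fun q z => picardC ν b k q z - picardLimitC ν b q z) (picardC ν b k) p x‖ +
          ‖duhamelC ν (picardLimitC ν b) (fun q z => picardC ν b k q z - picardLimitC ν b q z) p x‖ :=
        norm_add_le _ _
      _ ≤ lam * ε * (2 * freeConstC ι * M) + lam * (2 * freeConstC ι * M) * ε := by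
        refine add_le_add ?_ ?_
        · calc _ ≤ _ := h1
            _ = lam * ε * (2 * freeConstC ι * M) := by rw [hlam_def]
        · calc _ ≤ _ := h2
            _ = lam * (2 * freeConstC ι * M) * ε := by rw [hlam_def]
      _ = 2 * (lam * (2 * freeConstC ι * M)) * (4 * freeConstC ι * M / 2 ^ k) := by rw [hε]; ring
  have h1 : Tendsto (fun k => picardC ν b (k + 1) p x) atTop (𝓝 (picardLimitC ν b p x)) :=
    (tendsto_add_atTop_iff_nat 1).2 (tendsto_picardC hν hb hM hbM hsmall hp x)
  have h2 : Tendsto (fun k => picardC ν b (k + 1) p x) atTop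
      (𝓝 (freeTermC b p x - duhamelC ν (picardLimitC ν b) (picardLimitC ν b) p x)) := by
    simp only [picardC_succ]
    exact tendsto_const_nhds.sub hD
  exact tendsto_nhds_unique h1 h2

/-- **The limit is real on the real time axis**: `U(√(νt), 0) z = cx (Re U(√(νt), 0) z)` for
`0 < t < T₀`. [folklore] -/
theorem picardLimitC_real {t : ℝ} (ht : t ∈ Ioo 0 T₀) (z : EuclideanSpace ℝ ι) :
    picardLimitC ν b ((((Real.sqrt (ν * t) : ℝ) : ℂ)), 0) z =
      complexify (realPart (picardLimitC ν b ((((Real.sqrt (ν * t) : ℝ) : ℂ)), 0) z)) :=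
  real_on_axis_of_tendsto (V := fun k => picardC ν b k) (U := picardLimitC ν b)
    (fun k _ ht z => ⟨_, picardC_real hν b k ht.1 z⟩)
    (fun _ ht z => tendsto_picardC hν hb hM hbM hsmall (sqrt_mem_schemeDomain hν ht.1 ht.2) z) t ht z

/-- **The limit is Galilean covariant** on `schemeDomain ν T₀`. [folklore] -/
theorem isGalileanCovariantOn_picardLimitC :
    IsGalileanCovariantOn (schemeDomain ν T₀) (picardLimitC ν b) :=
  IsGalileanCovariantOn.of_tendsto (l := atTop) (V := fun k => picardC ν b k)
    (fun k => isGalileanCovariantOn_picardC ν T₀ b k)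
    (fun _ hq z => tendsto_picardC hν hb hM hbM hsmall hq z)

/-! ### The real solution -/

/-- On the axis the limit is the complexification of its real restriction:
`U(√(νt), 0) z = cx (u t z)`, `0 < t < T₀`. [folklore] -/
theorem complexify_picardLimitReal {t : ℝ} (ht : t ∈ Ioo 0 T₀) (z : EuclideanSpace ℝ ι) :
    complexify (picardLimitReal ν b t z) = picardLimitC ν b ((((Real.sqrt (ν * t) : ℝ) : ℂ)), 0) z :=
  (picardLimitC_real hν hb hM hbM hsmall ht z).symm

/-- **The real restriction solves Oseen's integral equation** from the datum `b` with initial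
time `0`, pointwise on `(0, T₀) × ℝ^ι`: `u(t) = e^{νtΔ} b - B^ν_0(u, u)(t)` (the fixed-point
equation at the real parameters `(√(νt), 0)`, where the free term is the caloric extension and
the bilinear term is the real Duhamel term, `scheme_sqrt_zero`; Lemarié-Rieusset 2016, (9.38):
on the window the mild solution is given by Oseen's expansion). [cite: LemarieRieusset2016, Thm. 9.12 (proof, (9.38), p. 260)] -/
theorem picardLimitReal_eq {t : ℝ} (ht : t ∈ Ioo 0 T₀) (z : EuclideanSpace ℝ ι) :
    picardLimitReal ν b t z =
      heatExtension b (ν * t) z - oseenDuhamel ν 0 (picardLimitReal ν b) (picardLimitReal ν b) t z := by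
  apply complexify_injective
  rw [complexify_picardLimitReal hν hb hM hbM hsmall ht z,
    picardLimitC_eq hν hb hM hbM hsmall (sqrt_mem_schemeDomain hν ht.1 ht.2) z,
    scheme_sqrt_zero hν (V := picardLimitC ν b) (v := picardLimitReal ν b)
      (fun σ hσ w => (complexify_picardLimitReal hν hb hM hbM hsmall hσ w).symm) b ht z]

/-- The real solution is bounded by `2 K_G M` on `(0, T₀) × ℝ^ι`. [folklore] -/
theorem norm_picardLimitReal_le {t : ℝ} (ht : t ∈ Ioo 0 T₀) (z : EuclideanSpace ℝ ι) :
    ‖picardLimitReal ν b t z‖ ≤ 2 * freeConstC ι * M := by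
  rw [← norm_complexify, complexify_picardLimitReal hν hb hM hbM hsmall ht z]
  exact norm_picardLimitC_le hν hb hM hbM hsmall (sqrt_mem_schemeDomain hν ht.1 ht.2) z

/-- The complexification of the real solution is jointly continuous on `(0, T₀) × ℝ^ι` (it is
the limit field along the continuous curve `t ↦ (√(νt), 0)` of the domain). [folklore] -/
theorem continuousOn_complexify_picardLimitReal :
    ContinuousOn (fun q : ℝ × EuclideanSpace ℝ ι => complexify (picardLimitReal ν b q.1 q.2))
      (Ioo 0 T₀ ×ˢ univ) := by
  have hpar : Continuous fun q : ℝ × EuclideanSpace ℝ ι =>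
      ((((((Real.sqrt (ν * q.1) : ℝ) : ℂ)), (0 : EuclideanSpace ℂ ι)), q.2) :
        (ℂ × EuclideanSpace ℂ ι) × EuclideanSpace ℝ ι) := by fun_prop
  have hmaps : MapsTo (fun q : ℝ × EuclideanSpace ℝ ι =>
      ((((((Real.sqrt (ν * q.1) : ℝ) : ℂ)), (0 : EuclideanSpace ℂ ι)), q.2) :
        (ℂ × EuclideanSpace ℂ ι) × EuclideanSpace ℝ ι)) (Ioo 0 T₀ ×ˢ univ)
      (schemeDomain ν T₀ ×ˢ univ) := by
    intro q hq
    obtain ⟨hq1, -⟩ := mem_prod.1 hq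
    exact mk_mem_prod (sqrt_mem_schemeDomain hν hq1.1 hq1.2) (mem_univ _)
  have h := (continuousOn_picardLimitC hν hb hM hbM hsmall).comp hpar.continuousOn hmaps
  refine h.congr fun q hq => ?_
  obtain ⟨hq1, -⟩ := mem_prod.1 hq
  exact complexify_picardLimitReal hν hb hM hbM hsmall hq1 q.2

/-- **The real solution is jointly continuous on `(0, T₀) × ℝ^ι`** (`cx` is an isometric
embedding). [folklore] -/
theorem continuousOn_uncurry_picardLimitReal :
    ContinuousOn (Function.uncurry (picardLimitReal ν b)) (Ioo 0 T₀ ×ˢ univ) := by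
  have hemb : IsEmbedding (complexify : EuclideanSpace ℝ ι → EuclideanSpace ℂ ι) :=
    (complexify : EuclideanSpace ℝ ι →ₗᵢ[ℝ] EuclideanSpace ℂ ι).isometry.isEmbedding
  rw [hemb.continuousOn_iff]
  exact continuousOn_complexify_picardLimitReal hν hb hM hbM hsmall

end Iteration

end Literature.Analysis.FluidPDE

end
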